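import Literature.NumberTheory.DiophantineGeometry.CatalanThaineAux
import Literature.NumberTheory.DiophantineGeometry.CatalanPUnitRoot
import Literature.NumberTheory.DiophantineGeometry.CatalanPUnitCoordinates
import Literature.NumberTheory.DiophantineGeometry.CatalanPlusThaineReduction
import Literature.NumberTheory.DiophantineGeometry.AbcWave0
import HarnessLib

/-!
# Mihăilescu's theorem (Catalan's conjecture) [Mihailescu2004, Theorem 1]: `mihailescu_holds`

The named fact `Literature.NumberTheory.DiophantineGeometry.mihailescu` of `AbcWave0`
("the only solution of `x^a - y^b = 1` in integers `x, y > 0`, `a, b ≥ 2` is `3² - 2³ = 1`",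
[Mihailescu2004, Theorem 1]) is **discharged** here: `theorem mihailescu_holds : mihailescu`.

The proof is the one of R. Schoof's book [Schoof2009] (an exposition of Mihăilescu's proof), whose
chapters are formalized in the `Catalan*` files of this directory:

* Ch. 1–4 (reduction to prime exponents; `q = 2`: V. A. Lebesgue 1850; `p = 2`: Ko Chao 1965 and
  Euler 1738) — `CatalanReduction`, `CatalanLebesgue`, `CatalanKoChao`, `CatalanNagell`,
  `CatalanEuler`, `CatalanZCbrt`, `CatalanAssembly`;
* Ch. 5–6 (Runge, Cassels) — `CatalanCassels*`; Ch. 7 (obstruction group) — `CatalanObstruction`;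
* Ch. 8 (Theorem IV, the `π`-adic argument) — `CatalanPiAdicLemmas`, `CatalanTheoremIV`;
* Ch. 9–11 (Stickelberger, double Wieferich = Theorem I, the minus argument = Theorem III) —
  `Stickelberger*` (in `NumberFields/`), `CatalanStickelberger*`, `CatalanWieferich`,
  `CatalanTheoremI`, `CatalanMinus*`, `CatalanTheoremIII*`;
* Ch. 12 (the plus argument I) — `CatalanPlusRunge`, `CatalanPlusEval`, `CatalanPlusSeries`,
  `CatalanPlusAnnihilator` (`Catalan.Plus.mihailescu_of_plus`);
* Ch. 13–14 (semisimple group rings, `E/E^q` free, the plus argument II) — `CatalanSemisimple`,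
  `CatalanTorsionQuotient`, `CatalanPUnitsFree`, `CatalanPUnitCoordinates`, `CatalanPlusRing`,
  `CatalanPlusIdeals`, `CatalanWittPolynomial`, `CatalanPlusThaineReduction`
  (`Catalan.PlusThaine.mihailescu_of_thaineK`: Catalan's conjecture from a Thaine-type
  annihilation statement `hT` in the language of `K = ℚ(ζ_p)`);
* Ch. 15–16 (Chebotarev, class field theory, Thaine's theorem) — `CatalanThaineField`,
  `CatalanThaineClaim`, `CatalanThaineNorm`, `CatalanThaine`, `CatalanThaineMain`,
  `CatalanThaineFrob`, `CatalanThaineDisjoint`, `CatalanThaineGalois`, `CatalanThaineAux`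
  (`Catalan.Thaine.thaine_main`: [Schoof2009, Theorem 16.3] with the auxiliary primes of
  [Schoof2009, Lemma 16.2]), on top of the tree's class field theory
  (`NumberFields/ClassFieldOfClassGroupCharacter`, `NumberFields/BauerSplitPrimes`, …).

This file supplies the last link, **`Catalan.Thaine.thaineK`**: the hypothesis `hT` of
`Catalan.PlusThaine.mihailescu_of_thaineK` — *for every `f : (ℤ/p)ˣ → ℕ` such that
`∏_c σ_c(ε π^m)^{f_c} ∈ C · E^q` for all `p`-units `ε π^m`, every ideal `∏_c (σ_c(I) σ_{-c}(I))^{f_c}`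
(`I ≠ 0`) is principal times a `q`-th power* — from `Catalan.Thaine.thaine_main`, as follows
([Schoof2009, p. 93, "Theorem 16.3 … says that the `𝔽_q[G⁺]`-annihilator of `E₃ = E/CE^q` also
annihilates `Cl⁺/Cl⁺^q`"]):

1. [Schoof2009, Prop. 13.7] (`Catalan.PUnits.exists_free_generator`) gives a generator `γ` of
   `G = (ℤ/p)ˣ` and a `p`-unit `u = ε₀ π^{k₀}` whose conjugates `σ_{γ^i}(u)`, `i < g = (p-1)/2`, form a
   basis of `E/E^q`; after multiplying `u` by a `q`-th power of `π` we may take `k₀ ≥ 0`, and the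
   independence clause gives `IndepModPowers q (σ_{γ^i}(u))_i` (`Catalan.PUnits.indepModPowers_of_free`,
   [Schoof2009, Exercise 16.3]); `ι(u) = u ρ^q` by [Schoof2009, Lemma 7.1 (ii)]
   (`Catalan.Coord.exists_gal_neg_one_punit`).
2. The hypothesis of `hT` at `u`, `u^f = c · w^q` (`c` cyclotomic, `w` a `p`-unit), symmetrised with
   `ι`: for the even vector `t = f + f∘ι` one gets `u^t = u^f ι(u^f) = c² · (w² ρ')^q`, which is the
   hypothesis `H` of `thaine_main` (after clearing the denominator, a power of `π^q`).
3. `thaine_main` ⟹ for every `I ≠ 0`, `∏_b σ_b(I ι I)^{t_b} = (∏_c (σ_c I σ_{-c} I)^{f_c})²` is principal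
   times a `q`-th power; since `q` is odd, so is `∏_c (σ_c I σ_{-c} I)^{f_c}` itself
   (`exists_span_mul_eq_of_sq`).

Everything is proved; no definition and no named fact is introduced.

## References

* P. Mihăilescu, *Primary cyclotomic units and a proof of Catalan's conjecture*, J. reine angew.
  Math. **572** (2004), 167–195, Theorem 1. [Mihailescu2004]
* R. Schoof, *Catalan's Conjecture*, Universitext, Springer 2009 — Chapter 1 (Theorems I–IV and the
  deduction of Catalan's conjecture, book pp. 4–5), Theorem 14.1 (pp. 92–93), Theorem 16.3 and
  Lemma 16.2 (pp. 109–114); held, `lit read book:schoof2009-catalan-s-conjecture`. [Schoof2009]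
* F. Thaine, *On the ideal class groups of real abelian number fields*, Ann. of Math. (2) **128**
  (1988), 1–18. [Thaine1988]
-/

namespace Literature.NumberTheory.DiophantineGeometry

namespace Catalan.Thaine

open _root_.NumberField Finset
open Literature.NumberTheory.NumberFields.Stickelberger Literature.NumberTheory.NumberFields.UnitGalois
open Literature.FieldTheory.Kummer Catalan.PUnits Catalan.Minus Catalan.Coord
open scoped Pointwise

/-! ### Two elementary lemmas -/

/-- Independence modulo `n`-th powers is insensitive to multiplying the family by `n`-th powers.
[folklore] -/
theorem indepModPowers_of_mul_pow {L : Type*} [Field L] {n k : ℕ} {c c' w : Fin k → L}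
    (hw : ∀ i, w i ≠ 0) (h : ∀ i, c' i = c i * w i ^ n) (hc : IndepModPowers n c) :
    IndepModPowers n c' := by
  intro v hx i
  obtain ⟨x, hx⟩ := hx
  have hD : ∏ i, c' i ^ v i = (∏ i, c i ^ v i) * (∏ i, w i ^ v i) ^ n := by
    rw [← Finset.prod_pow, ← Finset.prod_mul_distrib]
    refine Finset.prod_congr rfl fun i _ => ?_
    rw [h i, mul_zpow, ← zpow_natCast (w i) n, ← zpow_mul, mul_comm (n : ℤ), zpow_mul,
      zpow_natCast]
  set D : L := ∏ i, w i ^ v i with hDdef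
  have hD0 : D ≠ 0 := Finset.prod_ne_zero_iff.mpr fun i _ => zpow_ne_zero _ (hw i)
  refine hc v ⟨x / D, ?_⟩ i
  rw [div_pow, hx, hD, mul_div_assoc, div_self (pow_ne_zero _ hD0), mul_one]

/-- **Square roots modulo principal ideals and `q`-th powers, `q` odd**: if `Y²` is principal times a
`q`-th power (in the monoid of non-zero ideals modulo principal ideals), so is `Y = (Y²)^{(q+1)/2} / Y^q`.
[folklore] -/
theorem exists_span_mul_eq_of_sq {R : Type*} [CommRing R] [IsDedekindDomain R] {q : ℕ} (hq : Odd q)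
    {β₁ β₂ : R} {J₁ J₂ Y : Ideal R} (h₁ : β₁ ≠ 0) (h₂ : β₂ ≠ 0) (hJ₁ : J₁ ≠ ⊥) (hY : Y ≠ ⊥)
    (h : Ideal.span {β₁} * J₁ ^ q * Y ^ 2 = Ideal.span {β₂} * J₂ ^ q) :
    ∃ (J : Ideal R) (u v : R), u ≠ 0 ∧ v ≠ 0 ∧ Ideal.span {u} * Y = Ideal.span {v} * J ^ q := by
  obtain ⟨k, rfl⟩ := hq
  -- `h^(k+1)`: `β₁^(k+1) (J₁^(k+1))^q · Y · Y^q = β₂^(k+1) (J₂^(k+1))^q`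
  have h2 : Ideal.span {β₁ ^ (k + 1)} * (J₁ ^ (k + 1)) ^ (2 * k + 1) * (Y * Y ^ (2 * k + 1)) =
      Ideal.span {β₂ ^ (k + 1)} * (J₂ ^ (k + 1)) ^ (2 * k + 1) := by
    calc _ = (Ideal.span {β₁} * J₁ ^ (2 * k + 1) * Y ^ 2) ^ (k + 1) := by
          rw [← Ideal.span_singleton_pow]; ring
      _ = (Ideal.span {β₂} * J₂ ^ (2 * k + 1)) ^ (k + 1) := by rw [h]
      _ = _ := by rw [← Ideal.span_singleton_pow]; ring
  -- clear `J₁^(k+1) Y` from the `q`-th power on the left: `(y₀) = J₁^(k+1) Y M`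
  have hne : J₁ ^ (k + 1) * Y ≠ ⊥ := by
    rw [Ne, Ideal.mul_eq_bot, not_or]
    refine ⟨?_, hY⟩
    rw [← Ideal.zero_eq_bot] at hJ₁ ⊢
    exact pow_ne_zero _ hJ₁
  obtain ⟨y₀, hy₀, hy₀0⟩ := Submodule.exists_mem_ne_zero_of_ne_bot hne
  obtain ⟨M, hM⟩ : J₁ ^ (k + 1) * Y ∣ Ideal.span {y₀} :=
    Ideal.dvd_iff_le.mpr ((Ideal.span_singleton_le_iff_mem _).mpr hy₀)
  refine ⟨J₂ ^ (k + 1) * M, β₁ ^ (k + 1) * y₀ ^ (2 * k + 1), β₂ ^ (k + 1),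
    mul_ne_zero (pow_ne_zero _ h₁) (pow_ne_zero _ hy₀0), pow_ne_zero _ h₂, ?_⟩
  calc Ideal.span {β₁ ^ (k + 1) * y₀ ^ (2 * k + 1)} * Y
        = Ideal.span {β₁ ^ (k + 1)} * Ideal.span {y₀} ^ (2 * k + 1) * Y := by
        rw [← Ideal.span_singleton_mul_span_singleton, Ideal.span_singleton_pow]
    _ = Ideal.span {β₁ ^ (k + 1)} * (J₁ ^ (k + 1)) ^ (2 * k + 1) * (Y * Y ^ (2 * k + 1)) *
          M ^ (2 * k + 1) := by rw [hM]; ring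
    _ = Ideal.span {β₂ ^ (k + 1)} * (J₂ ^ (k + 1)) ^ (2 * k + 1) * M ^ (2 * k + 1) := by rw [h2]
    _ = _ := by ring

/-! ### Thaine's theorem in the `K`-language form `hT` -/

section ThaineK

variable {p : ℕ} [hp : Fact p.Prime] {K : Type} [Field K] [NumberField K]
  [hK : IsCyclotomicExtension {p} ℚ K] {ζ : K} (hζ : IsPrimitiveRoot ζ p)

include hK in
set_option maxHeartbeats 1600000 in
/-- **Thaine's theorem for `ℚ(ζ_p)` in `K`-language** — the hypothesis `hT` of
`Catalan.PlusThaine.mihailescu_of_thaineK` ([Schoof2009, Theorem 16.3] in the form used on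
[Schoof2009, p. 93]): let `p` be an odd prime and `q ≠ p` an odd prime with `q ∤ p - 1`; if
`f : (ℤ/p)ˣ → ℕ` is such that `∏_c σ_c(ε π^m)^{f_c}` is a cyclotomic `p`-unit times a `q`-th power of a
`p`-unit for every `p`-unit `ε π^m` ("`∑ f_c σ_c` annihilates `E/CE^q`"), then for every non-zero
ideal `I` of `𝓞 K` the ideal `∏_c (σ_c(I) σ_{-c}(I))^{f_c}` is principal times a `q`-th power
("`(1 + ι) ∑ f_c σ_c` annihilates `Cl/Cl^q`").  From `thaine_main` (module docstring, steps 1–3).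
[cite: Schoof2009, Theorem 16.3 with Lemma 16.2 (pp. 109–114); Theorem 14.1 (proof, p. 93)]
[cite: Thaine1988] -/
theorem thaineK (hp2 : p ≠ 2) {q : ℕ} [hq : Fact q.Prime] (hq2 : q ≠ 2) (hqp : q ≠ p)
    (hqd : ¬ q ∣ p - 1) (f : (ZMod p)ˣ → ℕ)
    (hf : ∀ (ε : (𝓞 K)ˣ) (m : ℤ), ∃ (n : (ZMod p)ˣ → ℕ) (ε' : (𝓞 K)ˣ) (m' : ℤ),
      ∏ c : (ZMod p)ˣ, (gal p K c (punit hζ ε m)) ^ f c =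
        (∏ a : (ZMod p)ˣ, (ζ ^ (a : ZMod p).val - 1) ^ n a) * punit hζ ε' m' ^ q)
    (I : Ideal (𝓞 K)) (hI : I ≠ ⊥) :
    ∃ (J : Ideal (𝓞 K)) (u v : 𝓞 K), u ≠ 0 ∧ v ≠ 0 ∧
      Ideal.span {u} * ∏ c : (ZMod p)ˣ, ((gal p K c • I) * (gal p K (-c) • I)) ^ f c =
        Ideal.span {v} * J ^ q := by
  classical
  -- ### numerics
  have hqo : Odd q := hq.out.odd_of_ne_two hq2
  have hpq : p ≠ q := fun h => hqp h.symm
  obtain ⟨g, hg⟩ : ∃ g, p - 1 = 2 * g := (hp.out.even_sub_one hp2).two_dvd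
  have hg0 : 0 < g := by
    have := hp.out.two_le
    omega
  haveI : NeZero g := ⟨hg0.ne'⟩
  have hqg : ¬ q ∣ g := fun hdiv => hqd (hdiv.trans ⟨2, by rw [hg, mul_comm]⟩)
  have hqcop : q.Coprime (2 * p) := Nat.Coprime.mul_right
    ((Nat.coprime_primes hq.out Nat.prime_two).mpr hq2) ((Nat.coprime_primes hq.out hp.out).mpr hqp)
  have hq0 : 0 < q := hq.out.pos
  have hπ0 : (((hζ.toInteger - 1 : 𝓞 K)) : K) ≠ 0 := piK_ne_zero hζ
  -- ### 1. the generator `u₀ = ε₀ π^{k₁}`, `k₁ ≥ 0`, of `E/E^q` [Schoof2009, Prop. 13.7]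
  obtain ⟨γ, ε₀, k₀, hγ, -, hii⟩ := exists_free_generator hζ hg hp2 hq2 hqp hqg
  obtain ⟨j, hj⟩ : ∃ j : ℕ, -k₀ ≤ (j : ℤ) := ⟨(-k₀).toNat, Int.self_le_toNat _⟩
  obtain ⟨k₁, hk₁⟩ : ∃ k₁ : ℤ, k₁ = k₀ + q * j := ⟨_, rfl⟩
  have hk₁0 : 0 ≤ k₁ := by
    have : (j : ℤ) ≤ q * j :=
      le_mul_of_one_le_left (Nat.cast_nonneg j) (by exact_mod_cast hq.out.one_lt.le)
    omega
  obtain ⟨mu, hmuk⟩ : ∃ mu : ℕ, (mu : ℤ) = k₁ := ⟨k₁.toNat, Int.toNat_of_nonneg hk₁0⟩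
  obtain ⟨u₀, hu₀⟩ : ∃ u₀ : 𝓞 K, u₀ = (ε₀ : 𝓞 K) * (hζ.toInteger - 1) ^ mu := ⟨_, rfl⟩
  -- `(u₀ : K) = ε₀ π^{k₁} = ε₀ π^{k₀} · (π^j)^q`
  have hu₀K : ((u₀ : 𝓞 K) : K) = punit hζ ε₀ k₁ := by
    rw [hu₀]
    unfold punit
    simp only [map_mul, map_pow]
    rw [← zpow_natCast, hmuk]
  have hk₀k₁ : punit hζ ε₀ k₁ = punit hζ ε₀ k₀ * punit hζ 1 j ^ q := by
    rw [punit_pow, one_pow, ← punit_mul, mul_one, hk₁]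
  -- independence modulo `q`-th powers of the conjugates of `u₀` [Schoof2009, Exercise 16.3]
  have hind : IndepModPowers q (fun i : Fin g => ((gal p K (γ ^ (i : ℕ)) • u₀ : 𝓞 K) : K)) := by
    refine indepModPowers_of_mul_pow (n := q)
      (c := fun i : Fin g => gal p K (γ ^ (i : ℕ)) (punit hζ ε₀ k₀))
      (w := fun i : Fin g => gal p K (γ ^ (i : ℕ)) (punit hζ 1 j))
      (fun i => gal_punit_ne_zero hζ _ _ _) (fun i => ?_) (indepModPowers_of_free hζ hq0 hii)
    show ((gal p K (γ ^ (i : ℕ)) • u₀ : 𝓞 K) : K) =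
      gal p K (γ ^ (i : ℕ)) (punit hζ ε₀ k₀) * (gal p K (γ ^ (i : ℕ)) (punit hζ 1 j)) ^ q
    rw [coe_gal_smul, hu₀K, hk₀k₁, map_mul, map_pow]
  -- `ι(u₀) = u₀ ρ^q` [Schoof2009, Lemma 7.1 (ii)]
  obtain ⟨tu, htu⟩ := exists_gal_neg_one_punit hζ hp2 hqcop ε₀ k₁
  have hT : punit hζ tu 0 = ((tu : 𝓞 K) : K) := by
    unfold punit
    rw [zpow_zero, mul_one]
  have hι : ∃ ρ : 𝓞 K, gal p K (-1) • u₀ = u₀ * ρ ^ q := by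
    refine ⟨tu, RingOfIntegers.ext ?_⟩
    rw [coe_gal_smul, hu₀K, htu, hT]
    simp only [map_mul, map_pow, hu₀K]
  -- ### 2. the hypothesis `H` of `thaine_main` for the even vector `t = f + f ∘ ι`
  obtain ⟨t, ht⟩ : ∃ t : (ZMod p)ˣ → ℕ, ∀ c, t c = f c + f (-c) := ⟨_, fun _ => rfl⟩
  have htsymm : ∀ b, t (-b) = t b := fun b => by rw [ht, ht, neg_neg, add_comm]
  obtain ⟨n, ε', m', hfU⟩ := hf ε₀ k₁
  -- `∏_a σ_a(ρ)^{f_a}` is a `p`-unit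
  obtain ⟨Etu, Mtu, hPT⟩ : ∃ (Etu : (𝓞 K)ˣ) (Mtu : ℤ),
      ∏ a, (gal p K a (punit hζ tu 0)) ^ f a = punit hζ Etu Mtu :=
    ⟨_, _, prod_gal_punit_pow hζ Finset.univ (fun a => a) (fun _ => tu) (fun _ => 0) f⟩
  obtain ⟨E, M, hEM⟩ : ∃ (E : (𝓞 K)ˣ) (M : ℤ),
      punit hζ E M = punit hζ ε' m' * punit hζ ε' m' * punit hζ Etu Mtu :=
    ⟨ε' * ε' * Etu, m' + m' + Mtu, by rw [punit_mul, punit_mul]⟩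
  -- `σ_{-a}(u₀) = σ_a(u₀) σ_a(ρ)^q`
  have e2 : ∀ a, gal p K (-a) (punit hζ ε₀ k₁) =
      gal p K a (punit hζ ε₀ k₁) * (gal p K a (punit hζ tu 0)) ^ q := by
    intro a
    rw [← mul_neg_one a, gal_mul, AlgEquiv.mul_apply, htu, map_mul, map_pow]
  have e3 : ∏ a, (gal p K (-a) (punit hζ ε₀ k₁)) ^ f a =
      (∏ a, (gal p K a (punit hζ ε₀ k₁)) ^ f a) * (∏ a, (gal p K a (punit hζ tu 0)) ^ f a) ^ q := by
    rw [← Finset.prod_pow, ← Finset.prod_mul_distrib]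
    refine Finset.prod_congr rfl fun a _ => ?_
    rw [e2, mul_pow, ← pow_mul, mul_comm q, pow_mul]
  -- `u₀^t = c² · (E π^M)^q` in `K`
  have hgalPowK : ((galPow t u₀ : 𝓞 K) : K) =
      (∏ a : (ZMod p)ˣ, (ζ ^ (a : ZMod p).val - 1) ^ n a) *
        (∏ a : (ZMod p)ˣ, (ζ ^ (a : ZMod p).val - 1) ^ n a) * punit hζ E M ^ q := by
    unfold galPow
    simp only [map_prod, map_pow, coe_gal_smul, hu₀K, ht]
    rw [show (∏ a, gal p K a (punit hζ ε₀ k₁) ^ (f a + f (-a))) =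
        (∏ a, (gal p K a (punit hζ ε₀ k₁)) ^ f a) * ∏ a, (gal p K (-a) (punit hζ ε₀ k₁)) ^ f a from by
      simp only [pow_add, Finset.prod_mul_distrib]
      congr 1
      exact (Fintype.prod_equiv (Equiv.neg (ZMod p)ˣ) _ _ fun a => by simp).symm]
    rw [e3, hfU, hPT, hEM]
    ring
  -- the cyclotomic element
  have e6 : ((cycElt hζ 0 0 (fun a => 2 * n a) : 𝓞 K) : K) =
      (∏ a : (ZMod p)ˣ, (ζ ^ (a : ZMod p).val - 1) ^ n a) *
        ∏ a : (ZMod p)ˣ, (ζ ^ (a : ZMod p).val - 1) ^ n a := by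
    have hz : algebraMap (𝓞 K) K hζ.toInteger = ζ := rfl
    unfold cycElt
    simp only [pow_zero, one_mul, map_prod, map_pow, map_sub, map_one, hz]
    rw [← Finset.prod_mul_distrib]
    exact Finset.prod_congr rfl fun a _ => by rw [two_mul, pow_add]
  -- clear the denominator: `M = mv - mw`
  obtain ⟨mv, mw, hMvw⟩ : ∃ mv mw : ℕ, M + mw = mv :=
    ⟨M.toNat, (-M).toNat, by have := Int.toNat_sub_toNat_neg M; omega⟩
  have e7 : punit hζ E M * (((hζ.toInteger - 1 : 𝓞 K)) : K) ^ mw =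
      ((E : 𝓞 K) : K) * (((hζ.toInteger - 1 : 𝓞 K)) : K) ^ mv := by
    unfold punit
    rw [mul_assoc, ← zpow_natCast _ mw, ← zpow_add₀ hπ0, hMvw, zpow_natCast]
  have H : galPow t u₀ * (((1 : (𝓞 K)ˣ) : 𝓞 K) * (hζ.toInteger - 1) ^ mw) ^ q =
      cycElt hζ 0 0 (fun a => 2 * n a) * ((E : 𝓞 K) * (hζ.toInteger - 1) ^ mv) ^ q := by
    apply RingOfIntegers.ext
    simp only [map_mul, map_pow, Units.val_one, one_mul, hgalPowK, e6]
    rw [mul_assoc, ← mul_pow]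
    simp only [e7]
  -- ### 3. Thaine's theorem and the square root
  obtain ⟨β₁, β₂, J₁, J₂, hβ₁, hβ₂, hJ₁, -, hrel⟩ :=
    thaine_main (K := K) hpq hq2 hg hg0 hγ hζ htsymm hu₀ hι hind H I hI
  -- `∏_b σ_b(I ιI)^{t_b} = (∏_c (σ_c I σ_{-c} I)^{f_c})²`
  set D : (ZMod p)ˣ → Ideal (𝓞 K) := fun c => (gal p K c • I) * (gal p K (-c) • I) with hD
  have hDneg : ∀ c, D (-c) = D c := fun c => by simp only [hD, neg_neg, mul_comm]
  have hprod : ∏ b, (gal p K b • (I * gal p K (-1) • I)) ^ t b = (∏ c, D c ^ f c) ^ 2 := by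
    have e1 : ∀ b, gal p K b • (I * gal p K (-1) • I) = D b := fun b => by
      simp only [hD, smul_mul', smul_smul, ← gal_mul, mul_neg_one]
    simp only [e1, ht, pow_add, Finset.prod_mul_distrib, sq]
    congr 1
    exact Fintype.prod_equiv (Equiv.neg (ZMod p)ˣ) _ _ fun c => by simp [hDneg]
  rw [hprod] at hrel
  have hY : ∏ c, D c ^ f c ≠ ⊥ := by
    rw [Ne, ← Ideal.zero_eq_bot]
    refine Finset.prod_ne_zero_iff.mpr fun c _ => pow_ne_zero _ ?_
    rw [Ideal.zero_eq_bot, hD]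
    exact mul_ne_bot' (gal_smul_ne_bot c hI) (gal_smul_ne_bot (-c) hI)
  exact exists_span_mul_eq_of_sq hqo hβ₁ hβ₂ hJ₁ hY hrel

end ThaineK

end Catalan.Thaine

/-! ### Catalan's conjecture -/

/-- **Mihăilescu's theorem (Catalan's conjecture, 1844–2002).** The only solution of
`x ^ a - y ^ b = 1` in integers `x, y > 0`, `a, b ≥ 2` is `3² - 2³ = 1`.  Proof: Schoof's book
[Schoof2009] as formalized in the `Catalan*` files (module docstring); the last step is
`Catalan.PlusThaine.mihailescu_of_thaineK` fed with Thaine's theorem `Catalan.Thaine.thaineK`.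
[cite: Mihailescu2004, Theorem 1] [cite: Schoof2009, Chapter 1 (pp. 4–5), Theorems I–IV] -/
theorem mihailescu_holds : mihailescu :=
  Catalan.PlusThaine.mihailescu_of_thaineK
    fun p q _ hq hq7 hqp hmod K _ _ _ _ζ hζ f hf I hI => by
      haveI : Fact q.Prime := ⟨hq⟩
      have hp1 : 1 ≤ p := by omega
      have hqd : ¬ q ∣ p - 1 := fun hd => hmod ((Nat.modEq_iff_dvd' hp1).mpr hd).symm
      exact Catalan.Thaine.thaineK hζ (by omega) (by omega) (by omega) hqd f hf I hI

end Literature.NumberTheory.DiophantineGeometry
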